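import Mathlib
import Summits.Ventures.PercRepro2.Graph

/-!
# A vertex with exactly two edges: connectivity through it (blind cell PercRepro2, p5 g31)

Let `v` be a vertex whose only edges are `e₁ = {v, o}` and `e₂ = {v, b}`.  Four elementary
facts about open connections, all proved with the closure lemma `mem_of_conn_of_closed`:

* **`conn_eq_v_of_isolated`**: if both edges are closed, `v` is connected to nothing but itself;
* **`conn_update_closed_of_conn`**: if `e₁` is closed, a connection between two vertices other
  than `v` survives closing `e₂` as well (no path between them passes through `v`);
* **`conn_v_iff`**: `a₁ ↔ v` iff `e₁` is open and `a₁ ↔ o`, or `e₂` is open and `a₁ ↔ b`;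
* **`conn_of_conn_update_open`**: a connection in the configuration with both edges open comes
  from a connection with both edges closed, or from two such connections joined through `v`
  (`x ↔ o` and `b ↔ y`, or `x ↔ b` and `o ↔ y`).

These are the graph-theoretic inputs of the pinning algebra at `v` for the pendant-root case of
row (LEAF-½) (`proofs/P5-OEDGE.md` §41 (3)).  Own work; standard axioms.
-/

namespace Summit.Ventures.PercRepro2

namespace StarTwoEdges

variable {V : Type*} {E : Type*} [DecidableEq E] {ends : E → Sym2 V} {e₁ e₂ : E} {v o b : V}

omit [DecidableEq E] in
/-- With both edges at `v` closed, `v` is connected only to itself. -/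
lemma conn_eq_v_of_isolated (hstar : ∀ f, v ∈ ends f → f = e₁ ∨ f = e₂) {ω : Config E}
    (h1 : ω e₁ = false) (h2 : ω e₂ = false) {x : V} (h : Conn ends ω v x) : x = v := by
  have hS : ∀ z ∈ ({v} : Set V), ∀ y, (openGraph ends ω).Adj z y → y ∈ ({v} : Set V) := by
    intro z hz y hzy
    rw [Set.mem_singleton_iff] at hz
    subst hz
    rw [openGraph_adj] at hzy
    obtain ⟨_, f, hf, hends⟩ := hzy
    have hv : z ∈ ends f := by rw [hends]; exact Sym2.mem_mk_left z y
    rcases hstar f hv with rfl | rfl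
    · rw [h1] at hf; exact absurd hf Bool.false_ne_true
    · rw [h2] at hf; exact absurd hf Bool.false_ne_true
  exact Set.mem_singleton_iff.1 (mem_of_conn_of_closed hS (Set.mem_singleton v) h)

/-- If `e₁` is closed, a connection between vertices other than `v` survives closing `e₂`. -/
lemma conn_update_closed_of_conn (h₁ : ends e₁ = s(v, o)) (h₂ : ends e₂ = s(v, b))
    (hstar : ∀ f, v ∈ ends f → f = e₁ ∨ f = e₂) (hvb : v ≠ b) {ω : Config E}
    (hω : ω e₁ = false) {x y : V} (hx : x ≠ v) (hy : y ≠ v) (h : Conn ends ω x y) :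
    Conn ends (Function.update ω e₂ false) x y := by
  classical
  set ω' := Function.update ω e₂ false with hω'
  have hω'1 : ω' e₁ = false := by
    by_cases h12 : e₁ = e₂
    · subst h12; simp [hω']
    · simp [hω', Function.update_of_ne h12, hω]
  have hω'2 : ω' e₂ = false := by simp [hω']
  -- the closure set: the `ω'`-cluster of `x`, plus `v` when `b` is in it
  let S : Set V := {z | Conn ends ω' x z ∨ (z = v ∧ Conn ends ω' x b)}
  have hS : ∀ z ∈ S, ∀ y', (openGraph ends ω).Adj z y' → y' ∈ S := by
    intro z hz y' hzy
    rw [openGraph_adj] at hzy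
    obtain ⟨hne, f, hf, hends⟩ := hzy
    by_cases hfv : v ∈ ends f
    · rcases hstar f hfv with rfl | rfl
      · rw [hω] at hf; exact absurd hf Bool.false_ne_true
      · -- `f = e₂ = {v, b}`
        rw [h₂] at hends
        rcases Sym2.eq_iff.1 hends with ⟨hzv, hyb⟩ | ⟨hzv, hyb⟩
        · -- `z = v`, `y' = b`: `v ∈ S` forces `x ↔ b` in `ω'`
          subst hyb; subst hzv
          rcases hz with hc | ⟨_, hcb⟩
          · exact absurd (conn_eq_v_of_isolated hstar hω'1 hω'2 (conn_symm hc)) hx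
          · exact Or.inl hcb
        · -- `z = b`, `y' = v`
          subst hyb; subst hzv
          rcases hz with hc | ⟨hzv', _⟩
          · exact Or.inr ⟨rfl, hc⟩
          · exact absurd hzv' hvb.symm
    · -- `f` does not touch `v`: it is open in `ω'` as well
      have hzv : z ≠ v := fun h => hfv (by rw [hends, ← h]; exact Sym2.mem_mk_left z y')
      have hy'v : y' ≠ v := fun h => hfv (by rw [hends, ← h]; exact Sym2.mem_mk_right z y')
      have hfe₂ : f ≠ e₂ := fun h => hfv (by rw [h, h₂]; exact Sym2.mem_mk_left v b)
      have hf' : ω' f = true := by simp [hω', Function.update_of_ne hfe₂, hf]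
      have hcz : Conn ends ω' x z := by
        rcases hz with hc | ⟨hzv', _⟩
        · exact hc
        · exact absurd hzv' hzv
      exact Or.inl (conn_trans hcz (conn_of_openAdj ⟨f, hf', hends⟩))
  have hxS : x ∈ S := Or.inl (conn_refl ends ω' x)
  rcases mem_of_conn_of_closed hS hxS h with hc | ⟨hyv, _⟩
  · exact hc
  · exact absurd hyv hy

omit [DecidableEq E] in
/-- `a₁ ↔ v` iff `e₁` is open and `a₁ ↔ o`, or `e₂` is open and `a₁ ↔ b`. -/
lemma conn_v_iff (h₁ : ends e₁ = s(v, o)) (h₂ : ends e₂ = s(v, b))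
    (hstar : ∀ f, v ∈ ends f → f = e₁ ∨ f = e₂) {ω : Config E} {a₁ : V} (ha : a₁ ≠ v) :
    Conn ends ω a₁ v ↔
      (ω e₁ = true ∧ Conn ends ω a₁ o) ∨ (ω e₂ = true ∧ Conn ends ω a₁ b) := by
  constructor
  · intro h
    let S : Set V := {z | Conn ends ω a₁ z ∧
      (z = v → (ω e₁ = true ∧ Conn ends ω a₁ o) ∨ (ω e₂ = true ∧ Conn ends ω a₁ b))}
    have hS : ∀ z ∈ S, ∀ y', (openGraph ends ω).Adj z y' → y' ∈ S := by
      intro z hz y' hzy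
      obtain ⟨hcz, hzv⟩ := hz
      rw [openGraph_adj] at hzy
      obtain ⟨hne, f, hf, hends⟩ := hzy
      refine ⟨conn_trans hcz (conn_of_openAdj ⟨f, hf, hends⟩), fun hy' => ?_⟩
      rw [hy'] at hends hne
      have hv : v ∈ ends f := by rw [hends]; exact Sym2.mem_mk_right z v
      rcases hstar f hv with rfl | rfl
      · rw [h₁] at hends
        rcases Sym2.eq_iff.1 hends with ⟨hz', _⟩ | ⟨_, hz'⟩
        · exact absurd hz'.symm hne
        · rw [← hz'] at hcz; exact Or.inl ⟨hf, hcz⟩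
      · rw [h₂] at hends
        rcases Sym2.eq_iff.1 hends with ⟨hz', _⟩ | ⟨_, hz'⟩
        · exact absurd hz'.symm hne
        · rw [← hz'] at hcz; exact Or.inr ⟨hf, hcz⟩
    have haS : a₁ ∈ S := ⟨conn_refl ends ω a₁, fun h' => absurd h' ha⟩
    exact (mem_of_conn_of_closed hS haS h).2 rfl
  · rintro (⟨hf, hc⟩ | ⟨hf, hc⟩)
    · exact conn_trans hc (conn_of_openAdj ⟨e₁, hf, by rw [h₁, Sym2.eq_swap]⟩)
    · exact conn_trans hc (conn_of_openAdj ⟨e₂, hf, by rw [h₂, Sym2.eq_swap]⟩)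

/-- A connection between vertices other than `v` in the configuration with both edges at `v`
open comes from the configuration with both edges closed, directly or through `v`. -/
lemma conn_of_conn_update_open (h₁ : ends e₁ = s(v, o)) (h₂ : ends e₂ = s(v, b))
    (hstar : ∀ f, v ∈ ends f → f = e₁ ∨ f = e₂) (h12 : e₁ ≠ e₂)
    {ω : Config E} {x y : V} (hx : x ≠ v) (hy : y ≠ v)
    (h : Conn ends (Function.update (Function.update ω e₁ true) e₂ true) x y) :
    Conn ends (Function.update (Function.update ω e₁ false) e₂ false) x y ∨
      (Conn ends (Function.update (Function.update ω e₁ false) e₂ false) x o ∧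
        Conn ends (Function.update (Function.update ω e₁ false) e₂ false) b y) ∨
      (Conn ends (Function.update (Function.update ω e₁ false) e₂ false) x b ∧
        Conn ends (Function.update (Function.update ω e₁ false) e₂ false) o y) := by
  classical
  set ω₁ := Function.update (Function.update ω e₁ true) e₂ true with hω₁
  set ω₀ := Function.update (Function.update ω e₁ false) e₂ false with hω₀
  have hω₀1 : ω₀ e₁ = false := by simp [hω₀, Function.update_of_ne h12]
  have hω₀2 : ω₀ e₂ = false := by simp [hω₀]
  -- the closure set
  let S : Set V := {z | Conn ends ω₀ x z ∨
    ((Conn ends ω₀ x o ∨ Conn ends ω₀ x b) ∧ (z = v ∨ Conn ends ω₀ o z ∨ Conn ends ω₀ b z))}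
  have hS : ∀ z ∈ S, ∀ y', (openGraph ends ω₁).Adj z y' → y' ∈ S := by
    intro z hz y' hzy
    rw [openGraph_adj] at hzy
    obtain ⟨hne, f, hf, hends⟩ := hzy
    by_cases hfv : v ∈ ends f
    · -- the edge is `e₁` or `e₂`
      have hbig : Conn ends ω₀ x o ∨ Conn ends ω₀ x b := by
        rcases hz with hc | ⟨hb, _⟩
        · -- `z` is in the `ω₀`-cluster of `x` and `f ∋ v` touches `z`: `z ∈ {o, b}` or `z = v`
          rcases hstar f hfv with rfl | rfl
          · rw [h₁] at hends
            rcases Sym2.eq_iff.1 hends with ⟨hz', _⟩ | ⟨_, hz'⟩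
            · subst hz'
              exact absurd (conn_eq_v_of_isolated hstar hω₀1 hω₀2 (conn_symm hc)) hx
            · subst hz'; exact Or.inl hc
          · rw [h₂] at hends
            rcases Sym2.eq_iff.1 hends with ⟨hz', _⟩ | ⟨_, hz'⟩
            · subst hz'
              exact absurd (conn_eq_v_of_isolated hstar hω₀1 hω₀2 (conn_symm hc)) hx
            · subst hz'; exact Or.inr hc
        · exact hb
      refine Or.inr ⟨hbig, ?_⟩
      rcases hstar f hfv with rfl | rfl
      · rw [h₁] at hends
        rcases Sym2.eq_iff.1 hends with ⟨_, hy'⟩ | ⟨hy', _⟩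
        · subst hy'; exact Or.inr (Or.inl (conn_refl ends ω₀ o))
        · subst hy'; exact Or.inl rfl
      · rw [h₂] at hends
        rcases Sym2.eq_iff.1 hends with ⟨_, hy'⟩ | ⟨hy', _⟩
        · subst hy'; exact Or.inr (Or.inr (conn_refl ends ω₀ b))
        · subst hy'; exact Or.inl rfl
    · -- `f` does not touch `v`: open in `ω₀`
      have hzv : z ≠ v := fun h => hfv (by rw [hends, ← h]; exact Sym2.mem_mk_left z y')
      have hfe₁ : f ≠ e₁ := fun h => hfv (by rw [h, h₁]; exact Sym2.mem_mk_left v o)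
      have hfe₂ : f ≠ e₂ := fun h => hfv (by rw [h, h₂]; exact Sym2.mem_mk_left v b)
      have hf0 : ω₀ f = true := by
        have : ω f = true := by simpa [hω₁, Function.update_of_ne hfe₁, Function.update_of_ne hfe₂] using hf
        simp [hω₀, Function.update_of_ne hfe₁, Function.update_of_ne hfe₂, this]
      have hadj : Conn ends ω₀ z y' := conn_of_openAdj ⟨f, hf0, hends⟩
      rcases hz with hc | ⟨hbig, hzz⟩
      · exact Or.inl (conn_trans hc hadj)
      · refine Or.inr ⟨hbig, ?_⟩
        rcases hzz with hzv' | hco | hcb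
        · exact absurd hzv' hzv
        · exact Or.inr (Or.inl (conn_trans hco hadj))
        · exact Or.inr (Or.inr (conn_trans hcb hadj))
  have hxS : x ∈ S := Or.inl (conn_refl ends ω₀ x)
  rcases mem_of_conn_of_closed hS hxS h with hc | ⟨hbig, hyy⟩
  · exact Or.inl hc
  · rcases hyy with hyv | hoy | hby
    · exact absurd hyv hy
    · rcases hbig with hxo | hxb
      · exact Or.inl (conn_trans hxo hoy)
      · exact Or.inr (Or.inr ⟨hxb, hoy⟩)
    · rcases hbig with hxo | hxb
      · exact Or.inr (Or.inl ⟨hxo, hby⟩)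
      · exact Or.inl (conn_trans hxb hby)

end StarTwoEdges

end Summit.Ventures.PercRepro2
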